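import Summits.ResolutionOfSingularities.ResolutionOfSingularities.Theses.UniformComplexity
import Summits.ResolutionOfSingularities.ResolutionOfSingularities.Theorems.UniformComplexityPrimeModelTransferSpecialization
import Summits.ResolutionOfSingularities.ResolutionOfSingularities.Theorems.UniformComplexityPrimeModelTransferAlgClosedTower
import Summits.ResolutionOfSingularities.ResolutionOfSingularities.Theorems.UniformComplexityCampaignW82AlgClosedKernel
import Mathlib.FieldTheory.IsAlgClosed.Basic
import HarnessLib

/-!
# Crux `PrimeModelTransfer` (stmt-ResolutionOfSingularities-8933), door 2 of slot W8.2: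
# NORMAL FORMS of the crux from the specialization theorem (by-name links)

Route `ResolutionOfSingularities/UniformComplexity`. With the specialization theorem
(`PrimeModelTransfer.integralResOver_of_integralResOver_extension`, p484634: `Res(L) ⇒ Res(K)` for
`K = K̄ ⊆ L` perfect) the crux `UniformComplexity.PrimeModelTransfer` acquires two exact normal
forms, proved here BY NAME (leaf file; imports the route file):

* `primeModelTransfer_iff_forall_isAlgClosed` — **resolution over algebraically closed fields of
  characteristic `p` is ALL-OR-NOTHING**: `PrimeModelTransfer` holds iff for every prime `p` and
  all algebraically closed `M`, `K` of characteristic `p`, `Res(M) ⇒ Res(K)`. (⇐ is trivial; ⇒: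
  `Res(M) ⇒ Res(k)` for every algebraically closed `k` algebraic over `𝔽_p`, since such `k` embeds
  into `M` (`IsAlgClosed.lift`) and the specialization theorem applies, then the crux climbs.)
* `primeModelTransfer_iff_climbAlgClosedStep` — **the crux is equivalent to its ONE-STEP instance
  between ALGEBRAICALLY CLOSED fields**: for `M` algebraically closed of characteristic `p` with
  `Res(M)`, `K ⊇ M` algebraically closed and `t ∈ K`, resolution holds over the algebraic closure
  of `M(t)` in `K`. No perfect closure, no purely inseparable extension and no `RatFunc` appear:
  door 2's residual is a statement about algebraically closed fields only. (⇐: the tower of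
  algebraically closed subfields, as in `exists_isAlgClosed_subfield_hasResolution` (p470438),
  and descent `hasResolution_of_perfectSubfields`; ⇒: specialization gives `Res(𝔽̄_p)` from
  `Res(M)`, then the crux.)

Also recorded: `isAlgebraic_of_forall_pow_prime_pow_eq_self` (the crux's algebraicity clause
`∀ x, ∃ n > 0, x^(p^n) = x` means algebraic over `ZMod p`) and
`integralResOver_of_isAlgClosed_of_primeModelHyp` (the crux hypothesis follows from `Res(M)` for
ANY algebraically closed `M` of characteristic `p`).

[OURS · LADDER-RESOLUTION L1, slot W8.2 (prime-field / universality transfer), door 2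
UniformComplexity] By-name links over the summit's own route; NOT statements of, and attributing
nothing to, Hironaka's 2017 manuscript. AI-written; weaker than expert review. Barrier
bookkeeping: the only field extensions along which resolutions are moved are of SMOOTH models
(specialization file); the fibre form of the transfer stays dead
(`RegularNotGeometricallyRegular`, `InseparableBaseChangeResolution`, `FrobeniusTwistResolution`).
-/

noncomputable section

set_option linter.dupNamespace false -- mandated namespace of this single-conjunct summit

open CategoryTheory CategoryTheory.Limits AlgebraicGeometry TopologicalSpace
open Literature.AlgebraicGeometry.Resolution
open Summit.ResolutionOfSingularities.ResolutionOfSingularities.Theses.UniformComplexity (PrimeModelTransfer)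

namespace Summit.ResolutionOfSingularities.ResolutionOfSingularities.Theorems.PrimeModelTransfer

/-! ## The crux hypothesis from resolution over any algebraically closed field -/

/-- The crux's algebraicity clause implies algebraicity: in a field `k` of characteristic `p`, if
every `x` satisfies `x ^ p ^ n = x` for some `n ≥ 1`, then `k` is algebraic over `ZMod p` (`x` is a
root of the non-zero polynomial `X ^ (p ^ n) - X`). [folklore] -/
theorem isAlgebraic_of_forall_pow_prime_pow_eq_self (p : ℕ) [Fact p.Prime] (k : Type) [Field k]
    [CharP k p] [Algebra (ZMod p) k] (hk : ∀ x : k, ∃ n : ℕ, 0 < n ∧ x ^ p ^ n = x) :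
    Algebra.IsAlgebraic (ZMod p) k := by
  refine ⟨fun x => ?_⟩
  obtain ⟨n, hn, hx⟩ := hk x
  have hdeg : 1 < p ^ n := Nat.one_lt_pow hn.ne' (Fact.out : p.Prime).one_lt
  refine ⟨Polynomial.X ^ (p ^ n) - Polynomial.X, ?_, ?_⟩
  · intro h
    have := congrArg Polynomial.natDegree h
    rw [Polynomial.natDegree_sub_eq_left_of_natDegree_lt (by simpa using hdeg),
      Polynomial.natDegree_X_pow, Polynomial.natDegree_zero] at this
    exact (Nat.pos_of_ne_zero (by omega) |>.ne') this |>.elim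
  · simp [hx]

/-- **The crux hypothesis holds as soon as ONE algebraically closed field of characteristic `p`
has resolution.** If `M` is algebraically closed of characteristic `p` and every integral separated
scheme of finite type over `M` has a resolution, then so does every one over every algebraically
closed `k` of characteristic `p` algebraic over `𝔽_p`: `k` embeds into `M` (`IsAlgClosed.lift`) and
the specialization theorem `integralResOver_of_integralResOver_extension` applies to `k ⊆ M`.
[folklore] -/
theorem integralResOver_of_isAlgClosed_of_primeModelHyp (p : ℕ) [Fact p.Prime]
    (M : Type) [Field M] [CharP M p] [IsAlgClosed M]
    (hM : ∀ (X : Scheme.{0}) (f : X ⟶ Spec (.of M)), IsSeparated f → LocallyOfFiniteType f →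
      QuasiCompact f → IsIntegral X → Scheme.HasResolution X)
    (k : Type) [Field k] [CharP k p] [IsAlgClosed k] (hk : ∀ x : k, ∃ n : ℕ, 0 < n ∧ x ^ p ^ n = x)
    (X : Scheme.{0}) (f : X ⟶ Spec (.of k)) (hs : IsSeparated f) (hl : LocallyOfFiniteType f)
    (hq : QuasiCompact f) (hX : IsIntegral X) : Scheme.HasResolution X := by
  letI : Algebra (ZMod p) k := ZMod.algebra k p
  letI : Algebra (ZMod p) M := ZMod.algebra M p
  haveI : Algebra.IsAlgebraic (ZMod p) k := isAlgebraic_of_forall_pow_prime_pow_eq_self p k hk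
  let ι : k →ₐ[ZMod p] M := IsAlgClosed.lift
  letI : Algebra k M := ι.toRingHom.toAlgebra
  haveI : PerfectField M := IsAlgClosed.perfectField M
  exact integralResOver_of_integralResOver_extension k M hM X f hs hl hq hX

/-- **Normal form 1: resolution over algebraically closed fields of characteristic `p` is
all-or-nothing.** `UniformComplexity.PrimeModelTransfer` holds iff for every prime `p` and all
algebraically closed fields `M`, `K` of characteristic `p`, resolution of all integral separated
schemes of finite type over `M` implies the same over `K`. (⇒: the crux hypothesis at `p` follows
from `Res(M)` by `integralResOver_of_isAlgClosed_of_primeModelHyp`; ⇐: take `M = k` algebraic over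
`𝔽_p`.) [folklore] -/
theorem primeModelTransfer_iff_forall_isAlgClosed :
    PrimeModelTransfer ↔ ∀ p : ℕ, p.Prime → ∀ (M : Type) [Field M] [CharP M p] [IsAlgClosed M],
      (∀ (X : Scheme.{0}) (f : X ⟶ Spec (.of M)), IsSeparated f → LocallyOfFiniteType f →
        QuasiCompact f → IsIntegral X → Scheme.HasResolution X) →
      ∀ (K : Type) [Field K] [CharP K p] [IsAlgClosed K] (X : Scheme.{0}) (f : X ⟶ Spec (.of K)),
        IsSeparated f → LocallyOfFiniteType f → QuasiCompact f → IsIntegral X →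
          Scheme.HasResolution X := by
  constructor
  · intro h p hp M _ _ _ hM K _ _ _ X f hs hl hq hX
    haveI : Fact p.Prime := ⟨hp⟩
    exact h p hp (fun k _ _ _ hk Y g hs' hl' hq' hY =>
      integralResOver_of_isAlgClosed_of_primeModelHyp p M hM k hk Y g hs' hl' hq' hY) K X f hs hl hq hX
  · intro h p hp hA K _ _ _ X f hs hl hq hX
    haveI : Fact p.Prime := ⟨hp⟩
    -- the prime model `𝔽̄_p` realised as `AlgebraicClosure (ZMod p)`
    let k₀ : Type := AlgebraicClosure (ZMod p)
    haveI : CharP k₀ p := charP_of_injective_algebraMap (algebraMap (ZMod p) k₀).injective p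
    have hk₀ : ∀ x : k₀, ∃ n : ℕ, 0 < n ∧ x ^ p ^ n = x := fun x =>
      pow_prime_pow_eq_self_of_isAlgebraic p x (Algebra.IsAlgebraic.isAlgebraic x)
    exact h p hp k₀ (hA k₀ hk₀) K X f hs hl hq hX

/-! ## The crux as a one-step climb between algebraically closed fields -/

/-- **The tower of algebraically closed subfields, from the one-step climb.** Let `K` be
algebraically closed of characteristic `p` with resolution over the algebraic closure of `𝔽_p` in
`K` (the crux hypothesis `hA`), and assume the ONE-STEP CLIMB between algebraically closed fields of characteristic `p`: for
`M` algebraically closed with resolution, `K' ⊇ M` algebraically closed and `t ∈ K'`, resolution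
over the algebraic closure of `M(t)` in `K'`. Then every finite `S ⊆ K` lies in an algebraically
closed subfield of `K` with resolution (induction on `S`, as in
`exists_isAlgClosed_subfield_hasResolution`, p470438, whose step is replaced by the hypothesis).
[folklore] -/
theorem exists_isAlgClosed_subfield_hasResolution_of_step (p : ℕ) [Fact p.Prime]
    (K : Type) [Field K] [CharP K p] [IsAlgClosed K]
    (hA : ∀ (k : Type) [Field k] [CharP k p] [IsAlgClosed k],
      (∀ x : k, ∃ n : ℕ, 0 < n ∧ x ^ p ^ n = x) →
      ∀ (X : Scheme.{0}) (f : X ⟶ Spec (.of k)), IsSeparated f → LocallyOfFiniteType f →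
        QuasiCompact f → IsIntegral X → Scheme.HasResolution X)
    (hstep : ∀ (M : Type) [Field M] [CharP M p] [IsAlgClosed M],
      (∀ (X : Scheme.{0}) (f : X ⟶ Spec (.of M)), IsSeparated f → LocallyOfFiniteType f →
        QuasiCompact f → IsIntegral X → Scheme.HasResolution X) →
      ∀ (K' : Type) [Field K'] [IsAlgClosed K'] [Algebra M K'] (t : K') (X : Scheme.{0})
        (f : X ⟶ Spec (.of (algebraicClosure (IntermediateField.adjoin M ({t} : Set K')) K'))),
        IsSeparated f → LocallyOfFiniteType f → QuasiCompact f → IsIntegral X →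
          Scheme.HasResolution X)
    (S : Finset K) :
    ∃ A : Subfield K, (↑S : Set K) ⊆ A ∧ IsAlgClosed A ∧
      ∀ (X : Scheme.{0}) (f : X ⟶ Spec (.of A)), IsSeparated f → LocallyOfFiniteType f →
        QuasiCompact f → IsIntegral X → Scheme.HasResolution X := by
  classical
  letI : Algebra (ZMod p) K := ZMod.algebra K p
  induction S using Finset.induction_on with
  | empty =>
    let A₀ : IntermediateField (ZMod p) K := algebraicClosure (ZMod p) K
    haveI : IsAlgClosed A₀ := IsAlgClosure.isAlgClosed (ZMod p)
    haveI : CharP A₀ p := (algebraMap A₀ K).charP (algebraMap A₀ K).injective p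
    have halg : ∀ x : A₀, ∃ n : ℕ, 0 < n ∧ x ^ p ^ n = x := fun x =>
      pow_prime_pow_eq_self_of_isAlgebraic p x (Algebra.IsAlgebraic.isAlgebraic x)
    exact ⟨A₀.toSubfield, by simp, inferInstanceAs (IsAlgClosed A₀),
      fun X f hs hl hq hX => hA A₀ halg X f hs hl hq hX⟩
  | insert t S _ ih =>
    obtain ⟨A, hSA, hAc, hAres⟩ := ih
    haveI : IsAlgClosed A := hAc
    haveI : CharP A p := (algebraMap A K).charP (algebraMap A K).injective p
    let E : IntermediateField A K := IntermediateField.adjoin A ({t} : Set K)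
    let L : IntermediateField E K := algebraicClosure E K
    haveI : IsAlgClosed L := IsAlgClosure.isAlgClosed E
    refine ⟨L.toSubfield, ?_, inferInstanceAs (IsAlgClosed L), ?_⟩
    · have hEL : ∀ x : K, x ∈ E → x ∈ L.toSubfield := fun x hx => by
        have := L.algebraMap_mem ⟨x, hx⟩
        simpa using this
      rw [Finset.coe_insert, Set.insert_subset_iff]
      refine ⟨hEL t (IntermediateField.mem_adjoin_simple_self A t), fun x hx => hEL x ?_⟩
      exact E.algebraMap_mem (⟨x, hSA hx⟩ : A)
    · exact fun X f hs hl hq hX => hstep A hAres K t X f hs hl hq hX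

/-- **Normal form 2: `PrimeModelTransfer` ⟺ the one-step climb between algebraically closed
fields.** `UniformComplexity.PrimeModelTransfer` holds iff for every prime `p`, every
algebraically closed `M` of characteristic `p` over which all integral separated schemes of finite
type are resolvable, every algebraically closed `K ⊇ M` and every `t ∈ K`, all integral separated
schemes of finite type over the algebraic closure of `M(t)` in `K` are resolvable. (⇒: `Res(M)`
gives the crux hypothesis by specialization, `integralResOver_of_isAlgClosed_of_primeModelHyp`, and
the crux resolves over the algebraically closed field `(M(t))^{alg} ∩ K`; ⇐: tower
`exists_isAlgClosed_subfield_hasResolution_of_step` + descent `hasResolution_of_perfectSubfields`.)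
The residual of door 2 is thus a statement about algebraically closed fields only — no perfect
closures, no purely inseparable extensions. [folklore] -/
theorem primeModelTransfer_iff_climbAlgClosedStep :
    PrimeModelTransfer ↔ ∀ p : ℕ, p.Prime → ∀ (M : Type) [Field M] [CharP M p] [IsAlgClosed M],
      (∀ (X : Scheme.{0}) (f : X ⟶ Spec (.of M)), IsSeparated f → LocallyOfFiniteType f →
        QuasiCompact f → IsIntegral X → Scheme.HasResolution X) →
      ∀ (K : Type) [Field K] [IsAlgClosed K] [Algebra M K] (t : K) (X : Scheme.{0})
        (f : X ⟶ Spec (.of (algebraicClosure (IntermediateField.adjoin M ({t} : Set K)) K))),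
        IsSeparated f → LocallyOfFiniteType f → QuasiCompact f → IsIntegral X →
          Scheme.HasResolution X := by
  constructor
  · intro h p hp M _ _ _ hM K _ _ _ t X f hs hl hq hX
    haveI : Fact p.Prime := ⟨hp⟩
    let E : IntermediateField M K := IntermediateField.adjoin M ({t} : Set K)
    let L : IntermediateField E K := algebraicClosure E K
    haveI : IsAlgClosed L := IsAlgClosure.isAlgClosed E
    haveI : CharP K p := charP_of_injective_algebraMap (algebraMap M K).injective p
    haveI : CharP L p := (algebraMap L K).charP (algebraMap L K).injective p
    exact (primeModelTransfer_iff_forall_isAlgClosed.mp h) p hp M hM L X f hs hl hq hX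
  · intro h p hp hA K _ _ _ X f hs hl hq hX
    haveI : Fact p.Prime := ⟨hp⟩
    haveI : PerfectField K := IsAlgClosed.perfectField K
    refine hasResolution_of_perfectSubfields K (fun s => ?_) X f hs hl hq hX
    obtain ⟨A, hsA, hAc, hAres⟩ :=
      exists_isAlgClosed_subfield_hasResolution_of_step p K (fun k _ _ _ hk => hA k hk)
        (fun M _ _ _ hM K' _ _ _ t => h p hp M hM K' t) s
    haveI : IsAlgClosed A := hAc
    exact ⟨A, hsA, IsAlgClosed.perfectField A, hAres⟩

/-! ## Appendix (v2): the residual of record implies the exact residual -/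

/-- **The lane-signed door-2 residual implies the one-step climb between algebraically closed
fields.** At a prime `p`, `CampaignW82.ClimbRatFuncPerfAlgClosed p` (p470934: for `M`
algebraically closed with resolution, resolution over every perfect field purely inseparable over
`RatFunc M`) gives, for every algebraically closed `K ⊇ M` and `t ∈ K`, resolution over the
algebraic closure of `M(t)` in `K` (`hasResolution_algebraicClosure_adjoin_simple`, p470438: the
kernel at `M` on `perfectClosure M(t)`, then the landed algebraic climb). With
`primeModelTransfer_iff_climbAlgClosedStep` this re-derives p473045's
`primeModelTransfer_of_forall_climbRatFuncPerfAlgClosed`; the converse implication is NOT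
available (it would descend resolution from `(M(t))^{alg}` to the perfect, non-closed
`M(t)^{perf}` — crux `DescentAlgclosedToPerfect`, stmt-0550). [folklore] -/
theorem climbAlgClosedStep_of_climbRatFuncPerfAlgClosed {p : ℕ} (hp : p.Prime)
    (h : CampaignW82.ClimbRatFuncPerfAlgClosed p)
    (M : Type) [Field M] [CharP M p] [IsAlgClosed M]
    (hM : ∀ (X : Scheme.{0}) (f : X ⟶ Spec (.of M)), IsSeparated f → LocallyOfFiniteType f →
      QuasiCompact f → IsIntegral X → Scheme.HasResolution X)
    (K : Type) [Field K] [IsAlgClosed K] [Algebra M K] (t : K) (X : Scheme.{0})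
    (f : X ⟶ Spec (.of (algebraicClosure (IntermediateField.adjoin M ({t} : Set K)) K)))
    (hs : IsSeparated f) (hl : LocallyOfFiniteType f) (hq : QuasiCompact f) (hX : IsIntegral X) :
    Scheme.HasResolution X := by
  haveI : Fact p.Prime := ⟨hp⟩
  haveI : PerfectField M := IsAlgClosed.perfectField M
  exact hasResolution_algebraicClosure_adjoin_simple p M hM (fun L _ _ _ _ => h M hM L) K t X f
    hs hl hq hX

/-- Hence **`∀ p, ClimbRatFuncPerfAlgClosed p` implies `PrimeModelTransfer`** through the exact
normal form (re-derivation of p473045 via `primeModelTransfer_iff_climbAlgClosedStep`).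
[folklore] -/
theorem primeModelTransfer_of_forall_climbRatFuncPerfAlgClosed'
    (h : ∀ p : ℕ, p.Prime → CampaignW82.ClimbRatFuncPerfAlgClosed p) : PrimeModelTransfer :=
  primeModelTransfer_iff_climbAlgClosedStep.mpr fun p hp M _ _ _ hM K _ _ _ t X f hs hl hq hX =>
    climbAlgClosedStep_of_climbRatFuncPerfAlgClosed hp (h p hp) M hM K t X f hs hl hq hX

end Summit.ResolutionOfSingularities.ResolutionOfSingularities.Theorems.PrimeModelTransfer

end
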